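import Mathlib
import Summits.AtomisticToContinuum.Crystallization.Theses.ChessboardParticlePlanes
import Summits.AtomisticToContinuum.Crystallization.Theorems.ChargedEnergyGap.Negative.Unconditional
import Summits.AtomisticToContinuum.Crystallization.Theorems.ChessboardParticlePlanesLjLaminarWindowsMinDistance
import Summits.AtomisticToContinuum.Crystallization.Theorems.ChessboardParticlePlanesLjLaminarWindowsOneWindow
import HarnessLib

/-!
# `LjLaminarWindows` from an energy gap for uniformly non-laminar configurations — line `Sketch`,
skeleton rev. 19 (lead c12), crux stmt-AtomisticToContinuum-6711

The crux `LjLaminarWindows` of route `ChessboardParticlePlanes` is equivalent to its one-window laminarity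
residual (tree theorems `LjLaminarWindows_iff_oneWindow`, rev. 17/18, and `LjLaminarWindows_iff_oneWindowAllScales`,
rev. 19): for every ground-state sequence, every `η > 0` and every radius `L`, frequently in `N`, SOME
particle-centred closed `L`-window is `η`-laminar.  This file records the natural GROUND-STATE-FREE sufficient
condition, a variational energy gap (registered stub `oneWindowAllScales_of_nonLaminarEnergyGap`):

* **(Gap)** for every radius `L` and thickness `η > 0` there are `c > 0` and `M₀` such that every
  `7/10`-separated configuration of `M ≥ M₀` points of `ℝ³` in which NO particle-centred closed `L`-window is
  `η`-laminar has Lennard-Jones energy `≥ (⨅_Q e(Q) + c)·M`.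

Given (Gap), laminar windows exist in ALL large ground states (`eventually_oneWindow_of_nonLaminarEnergyGap`), since
ground states are `7/10`-separated (`lennardJones_groundState_dist_ge_seven_tenths`, p115815) and
`E(N)/N → ⨅_Q e(Q)` (`ChargedEnergyGapNegative.crysEnergyLimit`, item 0626): a uniformly non-laminar ground state of
`N ≥ M₀` particles would have `E(N) ≥ (⨅e + c)N`, impossible for large `N`.  Hence (Gap) ⇒ the all-scales residual ⇒
the crux (`LjLaminarWindows_of_nonLaminarEnergyGap`).  No structural input on ground states (Earnshaw, removal,
non-spikiness, connectivity) is used beyond the energy limit and the minimal distance.  (Gap) is open: it says that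
the periodic infimum `⨅_Q e(Q)` of the Lennard-Jones energy density is separated by a positive gap from the energy
densities of all large configurations without a single laminar `L`-window — quantitative rigidity of near-minimisers,
the variational core of three-dimensional crystallization (Blanc–Lewin 2015, §2.3).
-/

noncomputable section

open Filter
open Literature.MathematicalPhysics.StatisticalMechanics
open Summit.AtomisticToContinuum.Crystallization.Theorems.ChargedEnergyGapNegative

namespace Summit.AtomisticToContinuum.Crystallization.Theorems.LjLaminarWindowsSketch

/-- **Laminar windows in all large ground states from the energy gap (Gap).** If for the given `L` and `η` every
`7/10`-separated configuration of `M ≥ M₀` points without an `η`-laminar particle-centred closed `L`-window has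
energy `≥ (⨅_Q e(Q) + c)·M` for some `c > 0`, then along every sequence of Lennard-Jones ground states, for all
large `N`, some particle-centred closed `L`-window IS `η`-laminar: otherwise `E(N) = 𝓔(x^N) ≥ (⨅e + c)N`,
contradicting `E(N)/N → ⨅e` (`crysEnergyLimit`); ground states are `7/10`-separated by
`lennardJones_groundState_dist_ge_seven_tenths`. [folklore] -/
theorem eventually_oneWindow_of_nonLaminarEnergyGap {L η : ℝ}
    (hGap : ∃ c : ℝ, 0 < c ∧ ∃ M₀ : ℕ, ∀ M : ℕ, M₀ ≤ M → ∀ y : Fin M → EuclideanSpace ℝ (Fin 3),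
      (∀ j k : Fin M, j ≠ k → (7 : ℝ) / 10 ≤ dist (y j) (y k)) →
      (¬ ∃ (i : Fin M) (A : EuclideanSpace ℝ (Fin 3) →ₗᵢ[ℝ] EuclideanSpace ℝ (Fin 3)) (T : Set ℝ),
          (∀ t ∈ T, ∀ t' ∈ T, t ≠ t' → (3 : ℝ) / 4 ≤ |t - t'|) ∧
          (∀ j : Fin M, dist (y j) (y i) ≤ L → ∃ t ∈ T, |(A (y j - y i)) 2 - t| ≤ η)) →
      ((⨅ Q : PeriodicConfiguration 3, Q.energyPerParticle lennardJones) + c) * M ≤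
        interactionEnergy lennardJones y)
    (x : (N : ℕ) → (Fin N → EuclideanSpace ℝ (Fin 3))) (hx : ∀ N, IsGroundState lennardJones (x N)) :
    ∀ᶠ N in Filter.atTop,
      ∃ (i : Fin N) (A : EuclideanSpace ℝ (Fin 3) →ₗᵢ[ℝ] EuclideanSpace ℝ (Fin 3)) (T : Set ℝ),
        (∀ t ∈ T, ∀ t' ∈ T, t ≠ t' → (3 : ℝ) / 4 ≤ |t - t'|) ∧
        (∀ j : Fin N, dist (x N j) (x N i) ≤ L → ∃ t ∈ T, |(A (x N j - x N i)) 2 - t| ≤ η) := by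
  obtain ⟨c, hc, M₀, hM₀⟩ := hGap
  -- eventually `E(N)/N < ⨅e + c`
  have hlim := crysEnergyLimit
  have hlt : ∀ᶠ N : ℕ in Filter.atTop, groundStateEnergy lennardJones 3 N / N <
      (⨅ Q : PeriodicConfiguration 3, Q.energyPerParticle lennardJones) + c :=
    hlim.eventually (gt_mem_nhds (by linarith))
  filter_upwards [hlt, Filter.eventually_ge_atTop M₀, Filter.eventually_ge_atTop 1] with N hN hNM₀ hN1
  by_contra hno
  have hsep : ∀ j k : Fin N, j ≠ k → (7 : ℝ) / 10 ≤ dist (x N j) (x N k) :=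
    fun j k hjk => lennardJones_groundState_dist_ge_seven_tenths (hx N) hjk
  have hE := hM₀ N hNM₀ (x N) hsep hno
  rw [(hx N).2] at hE
  have hNr : (0 : ℝ) < N := by exact_mod_cast hN1
  rw [div_lt_iff₀ hNr] at hN
  linarith

/-- **Registered stub `oneWindowAllScales_of_nonLaminarEnergyGap` (rev. 19, lead c12): the energy gap (Gap) for
uniformly non-laminar configurations, at every radius and thickness, implies the all-scales one-window residual S9♭
of the crux** (even with "for all large `N`" in place of "frequently in `N`"). [folklore] -/
theorem oneWindowAllScales_of_nonLaminarEnergyGap :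
    (∀ L η : ℝ, 0 < η → ∃ c : ℝ, 0 < c ∧ ∃ M₀ : ℕ, ∀ M : ℕ, M₀ ≤ M →
      ∀ y : Fin M → EuclideanSpace ℝ (Fin 3),
      (∀ j k : Fin M, j ≠ k → (7 : ℝ) / 10 ≤ dist (y j) (y k)) →
      (¬ ∃ (i : Fin M) (A : EuclideanSpace ℝ (Fin 3) →ₗᵢ[ℝ] EuclideanSpace ℝ (Fin 3)) (T : Set ℝ),
          (∀ t ∈ T, ∀ t' ∈ T, t ≠ t' → (3 : ℝ) / 4 ≤ |t - t'|) ∧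
          (∀ j : Fin M, dist (y j) (y i) ≤ L → ∃ t ∈ T, |(A (y j - y i)) 2 - t| ≤ η)) →
      ((⨅ Q : PeriodicConfiguration 3, Q.energyPerParticle lennardJones) + c) * M ≤
        interactionEnergy lennardJones y) →
    ∀ x : (N : ℕ) → (Fin N → EuclideanSpace ℝ (Fin 3)),
      (∀ N, IsGroundState lennardJones (x N)) →
      ∀ η : ℝ, 0 < η → ∀ L : ℝ, ∃ᶠ N in Filter.atTop,
        ∃ (i : Fin N) (A : EuclideanSpace ℝ (Fin 3) →ₗᵢ[ℝ] EuclideanSpace ℝ (Fin 3)) (T : Set ℝ),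
          (∀ t ∈ T, ∀ t' ∈ T, t ≠ t' → (3 : ℝ) / 4 ≤ |t - t'|) ∧
          (∀ j : Fin N, dist (x N j) (x N i) ≤ L → ∃ t ∈ T, |(A (x N j - x N i)) 2 - t| ≤ η) :=
  fun hGap x hx η hη L => (eventually_oneWindow_of_nonLaminarEnergyGap (hGap L η hη) x hx).frequently

/-- **(Gap) ⇒ the crux `LjLaminarWindows`** (through `LjLaminarWindows_of_oneWindow`, rev. 17/18, with `L₀ := 0`).
[folklore] -/
theorem LjLaminarWindows_of_nonLaminarEnergyGap
    (hGap : ∀ L η : ℝ, 0 < η → ∃ c : ℝ, 0 < c ∧ ∃ M₀ : ℕ, ∀ M : ℕ, M₀ ≤ M →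
      ∀ y : Fin M → EuclideanSpace ℝ (Fin 3),
      (∀ j k : Fin M, j ≠ k → (7 : ℝ) / 10 ≤ dist (y j) (y k)) →
      (¬ ∃ (i : Fin M) (A : EuclideanSpace ℝ (Fin 3) →ₗᵢ[ℝ] EuclideanSpace ℝ (Fin 3)) (T : Set ℝ),
          (∀ t ∈ T, ∀ t' ∈ T, t ≠ t' → (3 : ℝ) / 4 ≤ |t - t'|) ∧
          (∀ j : Fin M, dist (y j) (y i) ≤ L → ∃ t ∈ T, |(A (y j - y i)) 2 - t| ≤ η)) →
      ((⨅ Q : PeriodicConfiguration 3, Q.energyPerParticle lennardJones) + c) * M ≤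
        interactionEnergy lennardJones y) :
    Summit.AtomisticToContinuum.Crystallization.Theses.ChessboardParticlePlanes.LjLaminarWindows :=
  LjLaminarWindows_of_oneWindow fun x hx η hη =>
    ⟨0, fun L _ => oneWindowAllScales_of_nonLaminarEnergyGap hGap x hx η hη L⟩

end Summit.AtomisticToContinuum.Crystallization.Theorems.LjLaminarWindowsSketch

end
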